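import Literature.MathematicalPhysics.QuantumFieldTheory.QCDPhaseQuenchedMomentUpgrade
import Literature.MathematicalPhysics.QuantumFieldTheory.QCDHeavyQuarkPropagator
import HarnessLib

/-!
# Wick minors of the Wilson quark propagator: measurability and phase-quenched first moments

Topic `Literature/MathematicalPhysics/QuantumFieldTheory`; namespace
`Literature.MathematicalPhysics.QuantumFieldTheory`.  Companion to
`QCDPhaseQuenchedMomentUpgrade.lean` and `QCDHeavyQuarkPropagator.lean`.

The fermionic Wick expansion of lattice QCD expresses hadronic correlators as integrals, against
the phase-quenched measure `qcdLatticeMeasure` (`|det D|`-reweighted Wilson ensemble), of MINORS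
`det (G_U(p_a, q_b))_{a,b}` of the quark propagator `G_U = D(U)⁻¹`, `D(U) = diracMatrix U mq` the
flavour-diagonal Wilson–Dirac matrix (Montvay–Münster §4.1 (4.17)–(4.24), §5.1.6).  This file
records the elementary measure theory of these minors as functions of the gauge field:

* `measurable_det_of_measurable_apply` — a determinant of measurable entries is measurable
  (Leibniz expansion); `measurable_inv_diracMatrix_apply` — every propagator entry
  `U ↦ G_U(p, q)` is measurable (`D⁻¹ = (det D)⁻¹ • adj D`, continuity of `det`, `adj`);
  `measurable_det_inv_diracMatrix` — every Wick minor is measurable;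
* `inv_diracMatrix_apply_eq_zero_of_fst_ne` — propagator entries between DIFFERENT flavours vanish
  for every configuration (flavour-diagonal `D`; where `D` is singular Mathlib's `D⁻¹` is `0`);
  `norm_inv_diracMatrix_apply_le_blockSum` — an entry is bounded by the colour–spin block sum
  `Σ_{a,i,b,j} |G_U((f,x,a,i),(f,y,b,j))|` of its two sites (the quantity whose fractional moments
  the localisation statements control);
* `qcdLatticeMeasure_eq_zero_of_integral_eq_zero`, `qcdPhaseQuenchedExpect_eq_zero_of_integral_eq_zero`
  — the degenerate case `∫ |det D| dμ_W = 0`: the phase-quenched measure and `⟨·⟩₊` are then `0`;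
* `integrable_and_integral_le_of_rpow_one_add` — on a finite measure space a non-negative
  measurable `f` with `∫ f^{1+ε} < ∞` is integrable and `∫ f ≤ μ(Ω) + ∫ f^{1+ε}` (`f ≤ 1 + f^{1+ε}`);
  `integrable_norm_det_inv_diracMatrix_of_rpow` — hence a `(1+ε)`-moment bound `⟨|minor|^{1+ε}⟩₊ ≤ C`
  gives phase-quenched integrability of `|minor|` with `∫ |minor| ≤ 1 + C`.

Pure bookkeeping over the tree's objects (no localisation or decay is claimed).

## References

* I. Montvay, G. Münster, *Quantum Fields on a Lattice* (CUP 1994), §4.1, §5.1.6. [MontvayMunster1994]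
-/

noncomputable section

open MeasureTheory Filter
open Literature.MathematicalPhysics.QuantumLattice Literature.Probability.LatticeModels

namespace Literature.MathematicalPhysics.QuantumFieldTheory

/-! ### Measurability -/

/-- A determinant of measurable (complex) entries is measurable — Leibniz expansion
`det M = Σ_σ sgn σ ∏_i M_{σ i, i}`. [folklore] -/
theorem measurable_det_of_measurable_apply {Ω : Type*} [MeasurableSpace Ω] {n : Type*} [Fintype n]
    [DecidableEq n] {M : Ω → Matrix n n ℂ} (h : ∀ i j, Measurable fun ω => M ω i j) :
    Measurable fun ω => (M ω).det := by
  simp_rw [Matrix.det_apply']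
  refine Finset.measurable_sum _ fun σ _ => ?_
  exact (Finset.measurable_prod _ fun i _ => h (σ i) i).const_mul _

variable {Nf : ℕ} {S : ℕ} [NeZero S]

/-- **Every quark-propagator entry `U ↦ D(U)⁻¹(p, q)` is a measurable function of the gauge
field**: `D⁻¹ = (det D)⁻¹ · adj D` with `det D`, `adj D` continuous in `U` (polynomials in the link
entries) and `z ↦ z⁻¹` measurable on `ℂ`. [folklore] -/
theorem measurable_inv_diracMatrix_apply (mq : Fin Nf → ℝ) (p q : FermiIdx Nf S) :
    Measurable fun U : GaugeConfig 4 S SU3 => (diracMatrix U mq)⁻¹ p q := by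
  have h1 : (fun U : GaugeConfig 4 S SU3 => (diracMatrix U mq)⁻¹ p q) =
      fun U => ((diracMatrix U mq).det)⁻¹ * (diracMatrix U mq).adjugate p q := by
    funext U
    rw [Matrix.inv_def, Matrix.smul_apply, smul_eq_mul, Ring.inverse_eq_inv']
  rw [h1]
  exact (continuous_det_diracMatrix (S := S) mq).measurable.inv.mul
    (((continuous_diracMatrix (S := S) mq).matrix_adjugate).matrix_elem p q).measurable

/-- **Wick minors are measurable**: for any finite row/column index maps `I, J` into the quark
variables, `U ↦ det (D(U)⁻¹ (I a) (J b))_{a,b}` is measurable. [folklore] -/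
theorem measurable_det_inv_diracMatrix (mq : Fin Nf → ℝ) {ι : Type*} [Fintype ι] [DecidableEq ι]
    (I J : ι → FermiIdx Nf S) :
    Measurable fun U : GaugeConfig 4 S SU3 =>
      (Matrix.of fun a b => (diracMatrix U mq)⁻¹ (I a) (J b)).det :=
  measurable_det_of_measurable_apply fun a b => measurable_inv_diracMatrix_apply mq (I a) (J b)

/-! ### Flavour structure of the propagator -/

/-- **Propagator entries between different flavours vanish**, for every configuration: the
Wilson–Dirac matrix is flavour-diagonal, so its inverse is (`inv_diracMatrix_apply_of_ne`) — and
where some one-flavour determinant vanishes, `det D = 0` and Mathlib's `D⁻¹` is the zero matrix.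
[cite: MontvayMunster1994, §5.1 (flavour-diagonal Wilson action)] -/
theorem inv_diracMatrix_apply_eq_zero_of_fst_ne (U : GaugeConfig 4 S SU3) (mq : Fin Nf → ℝ)
    {v w : QuarkVar Nf S} (h : v.1 ≠ w.1) :
    (diracMatrix U mq)⁻¹ (quarkEquiv v) (quarkEquiv w) = 0 := by
  by_cases hdet : ∀ f, (wilsonDirac (fundamentalRep (Fin 3)) U (mq f) 1).det ≠ 0
  · obtain ⟨f, p⟩ := v
    obtain ⟨g, q⟩ := w
    exact inv_diracMatrix_apply_of_ne U mq hdet h p q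
  · push Not at hdet
    obtain ⟨f, hf⟩ := hdet
    have h0 : (diracMatrix U mq).det = 0 := by
      rw [det_diracMatrix]
      exact Finset.prod_eq_zero (Finset.mem_univ f) hf
    rw [Matrix.nonsing_inv_apply_not_isUnit _ (by rw [h0]; exact not_isUnit_zero), Matrix.zero_apply]

/-- **An entry is bounded by the colour–spin block sum of its two sites**:
`|G_U((f,x,c,i),(g,y,c',j))| ≤ Σ_{a,i',b,j'} |G_U((f,x,a,i'),(f,y,b,j'))|` — one term of the sum if
`g = f`, and `0` if `g ≠ f`. [folklore] -/
theorem norm_inv_diracMatrix_apply_le_blockSum (U : GaugeConfig 4 S SU3) (mq : Fin Nf → ℝ)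
    (f g : Fin Nf) (x y : TorusSite 4 S) (c : Fin 3) (i : Fin 4) (c' : Fin 3) (j : Fin 4) :
    ‖(diracMatrix U mq)⁻¹ (quarkEquiv (f, (x, c, i))) (quarkEquiv (g, (y, c', j)))‖ ≤
      ∑ a : Fin 3, ∑ i' : Fin 4, ∑ b : Fin 3, ∑ j' : Fin 4,
        ‖(diracMatrix U mq)⁻¹ (quarkEquiv (f, (x, a, i'))) (quarkEquiv (f, (y, b, j')))‖ := by
  by_cases hfg : f = g
  · subst hfg
    calc ‖(diracMatrix U mq)⁻¹ (quarkEquiv (f, (x, c, i))) (quarkEquiv (f, (y, c', j)))‖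
        ≤ ∑ j' : Fin 4, ‖(diracMatrix U mq)⁻¹ (quarkEquiv (f, (x, c, i))) (quarkEquiv (f, (y, c', j')))‖ :=
          Finset.single_le_sum (f := fun j' : Fin 4 =>
            ‖(diracMatrix U mq)⁻¹ (quarkEquiv (f, (x, c, i))) (quarkEquiv (f, (y, c', j')))‖)
            (fun _ _ => norm_nonneg _) (Finset.mem_univ j)
      _ ≤ ∑ b : Fin 3, ∑ j' : Fin 4,
            ‖(diracMatrix U mq)⁻¹ (quarkEquiv (f, (x, c, i))) (quarkEquiv (f, (y, b, j')))‖ :=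
          Finset.single_le_sum (f := fun b : Fin 3 => ∑ j' : Fin 4,
            ‖(diracMatrix U mq)⁻¹ (quarkEquiv (f, (x, c, i))) (quarkEquiv (f, (y, b, j')))‖)
            (fun _ _ => by positivity) (Finset.mem_univ c')
      _ ≤ ∑ i' : Fin 4, ∑ b : Fin 3, ∑ j' : Fin 4,
            ‖(diracMatrix U mq)⁻¹ (quarkEquiv (f, (x, c, i'))) (quarkEquiv (f, (y, b, j')))‖ :=
          Finset.single_le_sum (f := fun i' : Fin 4 => ∑ b : Fin 3, ∑ j' : Fin 4,
            ‖(diracMatrix U mq)⁻¹ (quarkEquiv (f, (x, c, i'))) (quarkEquiv (f, (y, b, j')))‖)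
            (fun _ _ => by positivity) (Finset.mem_univ i)
      _ ≤ _ :=
          Finset.single_le_sum (f := fun a : Fin 3 => ∑ i' : Fin 4, ∑ b : Fin 3, ∑ j' : Fin 4,
            ‖(diracMatrix U mq)⁻¹ (quarkEquiv (f, (x, a, i'))) (quarkEquiv (f, (y, b, j')))‖)
            (fun _ _ => by positivity) (Finset.mem_univ c)
  · rw [inv_diracMatrix_apply_eq_zero_of_fst_ne U mq (v := (f, (x, c, i))) (w := (g, (y, c', j))) hfg,
      norm_zero]
    positivity

/-! ### The degenerate case `∫ |det D| dμ_W = 0` -/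

/-- If the phase-quenched denominator vanishes then the phase-quenched measure `qcdLatticeMeasure`
is the zero measure (its un-normalised weight has total mass `Z_W · ∫ |det D| dμ_W = 0`). [folklore] -/
theorem qcdLatticeMeasure_eq_zero_of_integral_eq_zero (β : ℝ) (mq : Fin Nf → ℝ)
    (hZ : ∫ U, ‖(diracMatrix U mq).det‖ ∂(wilsonMeasure (d := 4) (L := S) (fundamentalRep (Fin 3)) β) = 0) :
    qcdLatticeMeasure S β mq = 0 := by
  have h : qcdLatticeWeight S β mq Set.univ = 0 := by
    rw [qcdLatticeWeight_univ, hZ, ENNReal.ofReal_zero, mul_zero]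
  rw [Measure.measure_univ_eq_zero] at h
  rw [qcdLatticeMeasure, h, smul_zero]

/-- If the phase-quenched denominator vanishes then `⟨φ⟩₊ = 0` for every observable (junk value
`0⁻¹ = 0`). [folklore] -/
theorem qcdPhaseQuenchedExpect_eq_zero_of_integral_eq_zero {E : Type*} [NormedAddCommGroup E]
    [NormedSpace ℝ E] (β : ℝ) (mq : Fin Nf → ℝ)
    (hZ : ∫ U, ‖(diracMatrix U mq).det‖ ∂(wilsonMeasure (d := 4) (L := S) (fundamentalRep (Fin 3)) β) = 0)
    (φ : GaugeConfig 4 S SU3 → E) : qcdPhaseQuenchedExpect β S mq φ = 0 := by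
  rw [qcdPhaseQuenchedExpect, hZ, inv_zero, zero_smul]

/-! ### First moments from `(1+ε)`-moments -/

/-- On a finite measure space a non-negative measurable `f` with `∫ f^{1+ε} dμ < ∞` (`ε ≥ 0`) is
integrable and `∫ f dμ ≤ μ(Ω) + ∫ f^{1+ε} dμ`, from the pointwise bound `f ≤ 1 + f^{1+ε}`. [folklore] -/
theorem integrable_and_integral_le_of_rpow_one_add {Ω : Type*} [MeasurableSpace Ω] (μ : Measure Ω)
    [IsFiniteMeasure μ] {f : Ω → ℝ} (hf0 : ∀ ω, 0 ≤ f ω) (hfm : Measurable f) {ε : ℝ} (hε : 0 ≤ ε)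
    (hfi : Integrable (fun ω => f ω ^ (1 + ε)) μ) :
    Integrable f μ ∧ ∫ ω, f ω ∂μ ≤ μ.real Set.univ + ∫ ω, f ω ^ (1 + ε) ∂μ := by
  have hle : ∀ ω, f ω ≤ 1 + f ω ^ (1 + ε) := fun ω => by
    rcases le_or_gt (f ω) 1 with h | h
    · linarith [Real.rpow_nonneg (hf0 ω) (1 + ε)]
    · have : f ω ^ (1 : ℝ) ≤ f ω ^ (1 + ε) := Real.rpow_le_rpow_of_exponent_le h.le (by linarith)
      rw [Real.rpow_one] at this
      linarith
  have hint : Integrable (fun ω => 1 + f ω ^ (1 + ε)) μ := (integrable_const 1).add hfi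
  have hfi' : Integrable f μ := hint.mono' hfm.aestronglyMeasurable
    (Eventually.of_forall fun ω => by rw [Real.norm_eq_abs, abs_of_nonneg (hf0 ω)]; exact hle ω)
  refine ⟨hfi', ?_⟩
  calc ∫ ω, f ω ∂μ ≤ ∫ ω, (1 + f ω ^ (1 + ε)) ∂μ := integral_mono hfi' hint hle
    _ = μ.real Set.univ + ∫ ω, f ω ^ (1 + ε) ∂μ := by
        rw [integral_add (integrable_const 1) hfi, integral_const, smul_eq_mul, mul_one]

/-- **Phase-quenched first moments of Wick minors from `(1+ε)`-moments.** If the weight is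
non-degenerate (`∫ |det D| dμ_W > 0`, so that `qcdLatticeMeasure` is a probability measure),
`|minor|^{1+ε}` is phase-quenched integrable and `⟨|minor|^{1+ε}⟩₊ ≤ C`, then `|minor|` is
phase-quenched integrable with `∫ |minor| d(qcdLatticeMeasure) ≤ 1 + C`. [folklore] -/
theorem integrable_norm_det_inv_diracMatrix_of_rpow (β : ℝ) (mq : Fin Nf → ℝ)
    (hZ : 0 < ∫ U, ‖(diracMatrix U mq).det‖ ∂(wilsonMeasure (d := 4) (L := S) (fundamentalRep (Fin 3)) β))
    {ι : Type*} [Fintype ι] [DecidableEq ι] (I J : ι → FermiIdx Nf S) {ε C : ℝ} (hε : 0 ≤ ε)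
    (hi : Integrable (fun U : GaugeConfig 4 S SU3 =>
        ‖(Matrix.of fun a b => (diracMatrix U mq)⁻¹ (I a) (J b)).det‖ ^ (1 + ε)) (qcdLatticeMeasure S β mq))
    (hC : qcdPhaseQuenchedExpect β S mq (fun U : GaugeConfig 4 S SU3 =>
        ‖(Matrix.of fun a b => (diracMatrix U mq)⁻¹ (I a) (J b)).det‖ ^ (1 + ε)) ≤ C) :
    Integrable (fun U : GaugeConfig 4 S SU3 =>
        ‖(Matrix.of fun a b => (diracMatrix U mq)⁻¹ (I a) (J b)).det‖) (qcdLatticeMeasure S β mq) ∧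
      ∫ U, ‖(Matrix.of fun a b => (diracMatrix U mq)⁻¹ (I a) (J b)).det‖ ∂(qcdLatticeMeasure S β mq) ≤
        1 + C := by
  haveI := isProbabilityMeasure_qcdLatticeMeasure (S := S) β mq hZ
  rw [qcdPhaseQuenchedExpect_eq_integral_qcdLatticeMeasure] at hC
  obtain ⟨h1, h2⟩ := integrable_and_integral_le_of_rpow_one_add (qcdLatticeMeasure S β mq)
    (fun U => norm_nonneg _) (measurable_det_inv_diracMatrix mq I J).norm hε hi
  rw [probReal_univ] at h2
  exact ⟨h1, h2.trans (by linarith)⟩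

end Literature.MathematicalPhysics.QuantumFieldTheory

end
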